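import Mathlib
import Literature.RingTheory.Koszul.RegularSequenceFirstHomology
import Literature.RingTheory.MvPolynomial.GradedNoetherNormalization
import Literature.RingTheory.MvPolynomial.HomogeneousHilbertFunction
import Literature.RingTheory.ZeroDimensional.FinitenessTheorem
import Literature.RingTheory.RegularLocalRing.SopRegular
import Literature.RingTheory.KrullDimension.HomogeneousCommonZero
import Literature.RingTheory.MvPolynomial.FormsCommonZero
import Literature.RingTheory.MvPolynomial.HomogeneousDimension
import Literature.Algebra.Polynomial.JacobianCriterion

/-!
# Route BarrierLever — item `GradientGenericFibreCount` (stmt-ValiantsHypothesis-19256),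
# part 1/6: Macaulay's H-basis property from Koszul syzygies

Let `H_i` be forms of degree `e ≥ 1` whose first Koszul homology vanishes
(`Literature.RingTheory.Koszul.HasKoszulSyzygies H`, e.g. a weakly regular sequence), and let
`F_i = H_i + (terms of degree < e)`. Then for every `p ∈ (F_1, …, F_m)` the top homogeneous component
of `p` (indeed every component of degree `≥ deg p`) lies in `(H_1, …, H_m)` — the `H_i` form an
H-basis (Macaulay basis) of the ideal of the `F_i` (`homogeneousComponent_mem_span_of_mem_span`,
`exists_lift_of_mem_idealDegree`). Consequence (parts 2–3): the standard monomials of `(H)` are a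
basis of `K[x]/(F − c)` for every `c`, so `dim_K K[x]/(F - c) = e^k`.

Lean text authored by the cell planner seat `valiant-natproofs-p2` (gen 4, HOME/HBasis-p2g4.lean,
1431 lines, kernel-checked rc 0 / 0 sorries; referee REF-G12 §4 and REF-G13 §2 PASS incl. full
line-read), ported by the prover seat (namespace `…Theorems.BarrierLever.HBasis`, six files, split
only). Stated over a general field `K` where the scratch does.

WHAT THIS IS NOT: nothing here touches FSV Question 6 / crux stmt-14610 or `VP` vs `VNP`; the item
is the algebro-geometric half of `NaturalProofsAgainstAllLinearSizes` (stmt-20156), whose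
complexity half is `NaturalProofsAgainstAllLinearSizesOfCount` (stmt-19261).

References: Macaulay 1916 (H-bases); [CoxLittleOSheaUsing2005] Ch. 3 Thm. (5.5); Hartshorne III
Cor. 10.7 (generic smoothness, replaced here by the Jacobian/Kähler argument); tree files
`Koszul.RegularSequenceFirstHomology`, `ZeroDimensional.FinitenessTheorem`, `RegularLocalRing.SopRegular`.
-/

-- layout Summits/ValiantsHypothesis/ValiantsHypothesis forces the duplicated namespace component
set_option linter.dupNamespace false

open MvPolynomial Finset

namespace Summit.ValiantsHypothesis.ValiantsHypothesis.Theorems.BarrierLever.HBasis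

variable {K : Type*} [Field K] {σ : Type*} {ι : Type*} [Fintype ι]

/-- Components of `s * u` below the degree of the form `u` vanish. -/
theorem homogeneousComponent_mul_eq_zero_of_lt {s u : MvPolynomial σ K} {a n : ℕ}
    (hu : u.IsHomogeneous a) (hn : n < a) : homogeneousComponent n (s * u) = 0 := by
  classical
  have hs : s * u = ∑ i ∈ Finset.range (s.totalDegree + 1), homogeneousComponent i s * u := by
    rw [← Finset.sum_mul, sum_homogeneousComponent]
  rw [hs, map_sum]
  refine Finset.sum_eq_zero fun i _ => ?_
  rw [homogeneousComponent_of_mem ((homogeneousComponent_isHomogeneous i s).mul hu), if_neg]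
  omega

/-- The component of degree `n` of `q * u`, `u` a form of degree `a`: `q_{n-a} u` if `a ≤ n`,
else `0`. -/
theorem homogeneousComponent_mul_form {q u : MvPolynomial σ K} {a n : ℕ}
    (hu : u.IsHomogeneous a) :
    homogeneousComponent n (q * u) =
      if a ≤ n then homogeneousComponent (n - a) q * u else 0 := by
  split_ifs with h
  · exact Literature.RingTheory.MvPolynomial.homogeneousComponent_mul_of_isHomogeneous hu h
  · exact homogeneousComponent_mul_eq_zero_of_lt hu (by omega)

/-- The top component of a non-zero polynomial is non-zero. -/
theorem homogeneousComponent_totalDegree_ne_zero {φ : MvPolynomial σ K} (hφ : φ ≠ 0) :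
    homogeneousComponent φ.totalDegree φ ≠ 0 := by
  classical
  have hne : φ.support.Nonempty := support_nonempty.mpr hφ
  obtain ⟨d, hd, hdeg⟩ := Finset.exists_mem_eq_sup φ.support hne (fun s => s.sum fun _ e => e)
  have hdeg' : d.degree = φ.totalDegree := by
    rw [totalDegree, hdeg]
    rfl
  intro h0
  have := congrArg (coeff d) h0
  rw [coeff_homogeneousComponent, if_pos hdeg', coeff_zero] at this
  exact (mem_support_iff.mp hd) this

/-- If `deg φ ≤ m` and the degree-`m` component of `φ` vanishes then `deg φ < m` (or `φ = 0`). -/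
theorem totalDegree_lt_of_homogeneousComponent_eq_zero {φ : MvPolynomial σ K} {m : ℕ}
    (hφ : φ ≠ 0) (hle : φ.totalDegree ≤ m) (h0 : homogeneousComponent m φ = 0) :
    φ.totalDegree < m := by
  rcases hle.lt_or_eq with h | h
  · exact h
  · exact absurd (h ▸ h0) (homogeneousComponent_totalDegree_ne_zero hφ)

section

variable {e : ℕ} (H F : ι → MvPolynomial σ K)

/-- The degree-`n` component of `Σ aᵢ Fᵢ` above the "representation degree": `Σ (aᵢ)_{n-e} Hᵢ`. -/
theorem homogeneousComponent_sum_mul {n : ℕ} (hH : ∀ i, (H i).IsHomogeneous e)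
    (hF : ∀ i, (F i - H i).totalDegree < e) (a : ι → MvPolynomial σ K)
    (ha : ∀ i, a i ≠ 0 → (a i).totalDegree + e ≤ n) :
    homogeneousComponent n (∑ i, a i * F i) = ∑ i, homogeneousComponent (n - e) (a i) * H i := by
  classical
  rw [map_sum]
  refine Finset.sum_congr rfl fun i _ => ?_
  by_cases hai : a i = 0
  · simp [hai]
  have hn := ha i hai
  have hsplit : a i * F i = a i * H i + a i * (F i - H i) := by ring
  rw [hsplit, map_add,
    Literature.RingTheory.MvPolynomial.homogeneousComponent_mul_of_isHomogeneous (hH i) (by omega),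
    homogeneousComponent_eq_zero _ (a i * (F i - H i)), add_zero]
  calc (a i * (F i - H i)).totalDegree ≤ (a i).totalDegree + (F i - H i).totalDegree :=
        totalDegree_mul _ _
    _ < n := by have := hF i; omega

/-- **Macaulay's H-basis property** (memo §4b, HBasisTop): with vanishing first Koszul homology of
the top forms `H`, every homogeneous component of degree `≥ deg p` of a member `p` of `(F)` lies
in `(H)`. -/
theorem homogeneousComponent_mem_span_of_mem_span (he : 1 ≤ e)
    (hH : ∀ i, (H i).IsHomogeneous e) (hF : ∀ i, (F i - H i).totalDegree < e)
    (hK : Literature.RingTheory.Koszul.HasKoszulSyzygies H)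
    {p : MvPolynomial σ K} (hp : p ∈ Ideal.span (Set.range F)) {t : ℕ}
    (ht : p.totalDegree ≤ t) : homogeneousComponent t p ∈ Ideal.span (Set.range H) := by
  classical
  obtain ⟨a₀, ha₀⟩ := Ideal.mem_span_range_iff_exists_fun.1 hp
  -- induction on the representation degree `D ≥ max (deg aᵢ + e)`
  suffices main : ∀ D : ℕ, ∀ a : ι → MvPolynomial σ K,
      (∀ i, a i ≠ 0 → (a i).totalDegree + e ≤ D) → ∑ i, a i * F i = p →
      homogeneousComponent t p ∈ Ideal.span (Set.range H) by
    exact main (Finset.univ.sup fun i => (a₀ i).totalDegree + e) a₀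
      (fun i _ => Finset.le_sup (f := fun i => (a₀ i).totalDegree + e) (Finset.mem_univ i)) ha₀
  intro D
  induction D using Nat.strong_induction_on with
  | _ D ih =>
    intro a ha hap
    by_cases hDt : D ≤ t
    · -- the component is read off the representation
      rw [← hap, homogeneousComponent_sum_mul H F hH hF a (fun i hi => (ha i hi).trans hDt)]
      exact Ideal.sum_mem _ fun i _ =>
        Ideal.mul_mem_left _ _ (Ideal.subset_span ⟨i, rfl⟩)
    · -- `t < D`: the degree-`D` component of `p` vanishes, giving a syzygy of the top forms
      have htD : t < D := by omega
      have hpD : homogeneousComponent D p = 0 :=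
        homogeneousComponent_eq_zero _ _ (by omega)
      have hsyz : ∑ i, homogeneousComponent (D - e) (a i) * H i = 0 := by
        rw [← homogeneousComponent_sum_mul H F hH hF a ha, hap, hpD]
      obtain ⟨A, hA⟩ := hK _ hsyz
      -- keep only the relevant homogeneous component of the Koszul coefficients
      let B : ι → ι → MvPolynomial σ K := fun i j =>
        if 2 * e ≤ D then homogeneousComponent (D - e - e) (A i j) else 0
      have hBhom : ∀ i j, (B i j).IsHomogeneous (D - e - e) := by
        intro i j
        simp only [B]
        split_ifs
        · exact homogeneousComponent_isHomogeneous _ _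
        · exact isHomogeneous_zero _ _ _
      have hB : ∀ i, homogeneousComponent (D - e) (a i) = ∑ j, (B i j - B j i) * H j := by
        intro i
        have h1 := congrArg (homogeneousComponent (D - e)) (hA i)
        rw [homogeneousComponent_eq_self (homogeneousComponent_isHomogeneous _ _), map_sum] at h1
        rw [h1]
        refine Finset.sum_congr rfl fun j _ => ?_
        rw [homogeneousComponent_mul_form (hH j)]
        simp only [B]
        by_cases h2 : 2 * e ≤ D
        · rw [if_pos (by omega), if_pos h2, if_pos h2, map_sub]
        · rw [if_neg (by omega), if_neg h2, if_neg h2, sub_zero, zero_mul]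
      -- the corrected representation
      let a' : ι → MvPolynomial σ K := fun i => a i - ∑ j, (B i j - B j i) * F j
      have hanti : ∑ i, (∑ j, (B i j - B j i) * F j) * F i = 0 := by
        simp_rw [Finset.sum_mul, sub_mul, Finset.sum_sub_distrib]
        rw [sub_eq_zero, Finset.sum_comm]
        exact Finset.sum_congr rfl fun i _ => Finset.sum_congr rfl fun j _ => by ring
      have hap' : ∑ i, a' i * F i = p := by
        calc ∑ i, a' i * F i = ∑ i, (a i * F i - (∑ j, (B i j - B j i) * F j) * F i) :=
              Finset.sum_congr rfl fun i _ => by simp only [a', sub_mul]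
          _ = p := by rw [Finset.sum_sub_distrib, hanti, sub_zero, hap]
      -- degree bookkeeping for `a'`
      have hdeg_le : ∀ i, (a' i).totalDegree ≤ D - e := by
        intro i
        refine (totalDegree_sub _ _).trans (max_le ?_ ?_)
        · by_cases hai : a i = 0
          · simp [hai]
          · have := ha i hai; omega
        · refine (totalDegree_finsetSum _ _).trans (Finset.sup_le fun j _ => ?_)
          by_cases h2 : 2 * e ≤ D
          · refine (totalDegree_mul _ _).trans ?_
            have hb : (B i j - B j i).totalDegree ≤ D - e - e :=
              ((hBhom i j).sub (hBhom j i)).totalDegree_le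
            have hFj : (F j).totalDegree ≤ e := by
              have h3 : F j = (F j - H j) + H j := by ring
              rw [h3]
              refine (totalDegree_add _ _).trans (max_le (hF j).le (hH j).totalDegree_le)
            omega
          · simp [B, h2]
      have htop : ∀ i, homogeneousComponent (D - e) (a' i) = 0 := by
        intro i
        simp only [a', map_sub, map_sum]
        rw [hB i, ← Finset.sum_sub_distrib]
        refine Finset.sum_eq_zero fun j _ => ?_
        by_cases h2 : 2 * e ≤ D
        · have hBB : (B i j - B j i).IsHomogeneous (D - e - e) := (hBhom i j).sub (hBhom j i)
          have h3 : (B i j - B j i) * F j =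
              (B i j - B j i) * H j + (B i j - B j i) * (F j - H j) := by ring
          rw [h3, map_add, homogeneousComponent_mul_form (hH j), if_pos (by omega),
            homogeneousComponent_eq_self hBB, homogeneousComponent_eq_zero, add_zero, sub_self]
          calc ((B i j - B j i) * (F j - H j)).totalDegree
              ≤ (B i j - B j i).totalDegree + (F j - H j).totalDegree := totalDegree_mul _ _
            _ < D - e := by have := hBB.totalDegree_le; have := hF j; omega
        · simp [B, h2]
      have ha' : ∀ i, a' i ≠ 0 → (a' i).totalDegree + e ≤ D - 1 := by
        intro i hi
        have := totalDegree_lt_of_homogeneousComponent_eq_zero hi (hdeg_le i) (htop i)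
        omega
      exact ih (D - 1) (by omega) a' ha' hap'


omit [Fintype ι] in
/-- `deg Fᵢ ≤ e`. -/
theorem totalDegree_le_of_top (hH : ∀ i, (H i).IsHomogeneous e)
    (hF : ∀ i, (F i - H i).totalDegree < e) (i : ι) : (F i).totalDegree ≤ e := by
  have h3 : F i = (F i - H i) + H i := by ring
  rw [h3]
  exact (totalDegree_add _ _).trans (max_le (hF i).le (hH i).totalDegree_le)

open Literature.RingTheory.MvPolynomial in
/-- Lifting: every form of degree `t` in `(H)` is the degree-`t` component of a member of `(F)` of
degree `≤ t`. -/
theorem exists_lift_of_mem_idealDegree (hH : ∀ i, (H i).IsHomogeneous e)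
    (hF : ∀ i, (F i - H i).totalDegree < e) (t : ℕ) (q : MvPolynomial σ K)
    (hq : q ∈ idealDegree (Ideal.span (Set.range H)) t) :
    ∃ p ∈ Ideal.span (Set.range F), p.totalDegree ≤ t ∧ homogeneousComponent t p = q := by
  classical
  obtain ⟨hqJ, hqhom⟩ := (mem_idealDegree).1 hq
  obtain ⟨b, hb⟩ := Ideal.mem_span_range_iff_exists_fun.1 hqJ
  by_cases het : e ≤ t
  · refine ⟨∑ i, homogeneousComponent (t - e) (b i) * F i, ?_, ?_, ?_⟩
    · exact Ideal.sum_mem _ fun i _ => Ideal.mul_mem_left _ _ (Ideal.subset_span ⟨i, rfl⟩)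
    · refine (totalDegree_finsetSum _ _).trans (Finset.sup_le fun i _ =>
        (totalDegree_mul _ _).trans ?_)
      have h1 := (homogeneousComponent_isHomogeneous (t - e) (b i)).totalDegree_le
      have hFi := totalDegree_le_of_top H F hH hF i
      omega
    · rw [homogeneousComponent_sum_mul H F hH hF _ (fun i _ => ?_)]
      · calc ∑ i, homogeneousComponent (t - e) (homogeneousComponent (t - e) (b i)) * H i
            = ∑ i, homogeneousComponent t (b i * H i) := Finset.sum_congr rfl fun i _ => by
                rw [homogeneousComponent_eq_self (homogeneousComponent_isHomogeneous _ _),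
                  homogeneousComponent_mul_form (hH i), if_pos het]
          _ = q := by rw [← map_sum, hb, homogeneousComponent_eq_self hqhom]
      · have := (homogeneousComponent_isHomogeneous (t - e) (b i)).totalDegree_le
        omega
  · refine ⟨0, Ideal.zero_mem _, by simp, ?_⟩
    rw [map_zero, ← homogeneousComponent_eq_self hqhom, ← hb, map_sum]
    symm
    exact Finset.sum_eq_zero fun i _ => by rw [homogeneousComponent_mul_form (hH i), if_neg het]

end

end Summit.ValiantsHypothesis.ValiantsHypothesis.Theorems.BarrierLever.HBasis
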